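import Summits.BirchSwinnertonDyer.Rank1Residual.X11b.BDPRouteSelmerFiniteRankOne
import Summits.BirchSwinnertonDyer.BirchSwinnertonDyer.Theorems.CongruentShaFreeCutTwoAdicControlOfSelmerFinite

/-! # Route `CongruentShaFreeCut` (rung S2) — crux `AnalyticRankOneOfRankOneFiniteShaTwo`
(stmt-BirchSwinnertonDyer-19080), Link A, Steps 1–4: Castella's Selmer group `Sel_𝔭(K, E[p^∞])` OVER
`K` is FINITE at a rank-one datum — WITHOUT `E[p]` irreducible, WITHOUT multiplicative reduction,
for ANY prime `p` (so at the additive prime `2` of `E_n`, where `E_n(K)[2] ≅ (ℤ/2)²`)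

Cell `bsd-cn100`, prover seat `bsd-cn100-s2-c3` g3. Supports, does not close, stmt-BirchSwinnertonDyer-19080.
HONEST FRAMING: label (B) of the b2b cell — CONDITIONAL on the two TEXTBOOK named facts
`poitouTate_sum_localTatePairing_eq_zero K` (Poitou–Tate, Milne ADT I Thm. 4.10 with Cor. 2.3) and
`localEulerPoincareCharacteristic (K_v)` (Tate's local Euler–Poincaré characteristic, Milne ADT I
Thm. 2.8), both hypotheses; nothing about BSD, crux B or the leaf is claimed.

## What is proved

The b2b cell proved (`X11b.selmerCardBoundTorsion_of_rankOne_primary`, gen 19) the JSW17 Prop. 3.2.1 (`≤`)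
bound, hence the finiteness, of Castella's group `Sel_𝔭(K, E[p^∞])` (strict at `𝔭`, relaxed at `𝔭̄`,
trivial off `p`; `X11b.AcSelmer.selmerAcBase`) at a rank-one datum under `Mult W p` (used only for
the exact exponent) and `Irr W p` (used only to kill the `p`-torsion of `E(K)`, through
`[E(K) : p^kE(K)] = p^k`). For the congruent number curves at `p = 2` both fail. This file re-runs the
same chain keeping ONLY what finiteness needs:

* `natCard_level_mul_le_of_indices` — the level bound of `SelmerLevelBound.natCard_level_le_of_indices_torsion`
  with the global index `[E(K) : p^kE(K)] ≤ N` DECOUPLED from the local one `[E(K_𝔭) : T + p^kE(K_𝔭)] = M`: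
  `#H¹_{𝓛^{(k)}}(K, E[p^k]) · M ≤ L₁ · (S · (N · L₂))` (Poitou–Tate at `𝔮`, local Euler characteristic,
  Part A with the torsion-valued condition at `𝔭`); no hypothesis on `E(K)[p]` or `E(K_𝔭)[p]`.
* `index_range_zsmul_le_mul_card_torsion` — for an abelian group with an integral coordinate of rank
  one and finite torsion `T`: `[A : nA] ≤ n · #T` (in place of `= n` when `A[p] = 0`).
* **`finite_selmerAcBase_of_rankOne`** — for an elliptic, globally minimal `W/ℚ`, ANY prime `p`, an
  imaginary quadratic `K` with `p` split, `rank E(K) = 1`, `#Ш(E/K)[p^∞] < ∞` and a prime `𝔭 ∋ p`: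
  `Sel_𝔭(K, E[p^∞])` is FINITE (granted the two textbook facts). Level bounds uniform in `k`
  (`≤ p^{e_Q}·#Ш[p^∞]·#E(K)_tors·p^{e_Q}`), then the limit `LevelKummer.exists_finite_selmerAcBase_natCard_le`.

* **`twoAdicControlOfRankOne_of_poitouTate_of_localEulerChar`** — with the landed reduction
  `CongruentShaFreeCutTwoAdicControlOfSelmerFinite.twoAdicControlOfRankOne_of_finite_selmerAcBase`
  (p429171: the `2`-adic tower part of Link A — local kernels incl. the strict place, control,
  Nakayama, Greenberg's criterion — discharged by X11b kernel theorems), this CLOSES Link A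
  `…CongruentShaFreeCutTwoAdicLinks.TwoAdicControlOfRankOne` MODULO the two textbook named facts,
  quantified over the number fields at which Link A is demanded. CONDITIONAL (label B); the
  registered fact-free stub `stub_twoAdicControlOfRankOne` stays open until those two facts are
  tree theorems; crux B's remaining research content is Link B `TwoAdicCharValueEqHeegnerLogSq`. [cite: JetchevSkinnerWan2017, Prop. 3.2.1 (proof, arXiv:1512.06894 pp. 10–11)]
[cite: Castella2018, proof of Thm. 2.3, (3.2.1) and (calcul) (arXiv:1704.06608 pp. 5–6)]
[cite: MilneADT2006, Ch. I, Thm. 4.10(b) and Thm. 2.8] [cite: GreenbergLNM1716, §3 p. 90] -/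

noncomputable section

open scoped Classical

universe u

namespace Summit.BirchSwinnertonDyer.BirchSwinnertonDyer.Theorems.CongruentShaFreeCutTwoAdicSelmerFinite

open WeierstrassCurve NumberField IsDedekindDomain Field Function
open Literature.NumberTheory.EllipticCurves Literature.NumberTheory.EllipticCurves.GreenbergSelmer
open Literature.NumberTheory.GaloisRepresentations Literature.NumberTheory.GaloisCohomology
open Summit.BirchSwinnertonDyer.Rank1Residual.X11b
open Summit.BirchSwinnertonDyer.Rank1Residual.X11b.AcSelmer
open Summit.BirchSwinnertonDyer.Rank1Residual.X11b.LocBridge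
open Summit.BirchSwinnertonDyer.Rank1Residual.X11b.SelmerLevelBound

/-! ## 1. Two pieces of torsion bookkeeping -/

/-- **`[A : nA] ≤ n · #A_tors`** for an abelian group `A` with an integral coordinate of rank one
(`c : A → ℤ` onto with torsion kernel) and finite torsion: `A → ℤ/n`, `x ↦ c(x) mod n` is onto with
kernel `nℤQ + A_tors ⊇ nA`, and `[nℤQ + A_tors : nA] ≤ #A_tors` (every class has a torsion
representative). Replaces `RankOne.index_range_zsmul_pow_eq` (`= n` when `A[p] = 0`).
[cite: JetchevSkinnerWan2017, Prop. 3.2.1 (proof, arXiv:1512.06894 p. 10), `E(K)/p^k E(K)` for rank one] -/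
theorem index_range_zsmul_le_mul_card_torsion {A : Type*} [AddCommGroup A] (c : A →+ ℤ) (Q : A)
    (hQ : c Q = 1) (hker : ∀ x : A, c x = 0 → IsOfFinAddOrder x)
    [Finite (AddCommGroup.torsion A)] (n : ℕ) [NeZero n] :
    ((zsmulAddGroupHom (n : ℤ) : A →+ A).range).index ≤ n * Nat.card (AddCommGroup.torsion A) := by
  set f : A →+ ZMod n := (Int.castAddHom (ZMod n)).comp c with hf
  set H := (zsmulAddGroupHom (n : ℤ) : A →+ A).range with hH
  have hfs : Function.Surjective f :=
    (ZMod.intCast_surjective (n := n)).comp (RankOne.coord_surjective c Q hQ)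
  have hHle : H ≤ f.ker := by
    rintro _ ⟨y, rfl⟩
    rw [AddMonoidHom.mem_ker, zsmulAddGroupHom_apply]
    change (((c ((n : ℤ) • y) : ℤ)) : ZMod n) = 0
    rw [map_zsmul, smul_eq_mul, Int.cast_mul, Int.cast_natCast, ZMod.natCast_self, zero_mul]
  have hkidx : f.ker.index = n := by
    rw [AddSubgroup.index_ker, AddMonoidHom.range_eq_top.mpr hfs, AddSubgroup.card_top, Nat.card_zmod]
  -- `[ker f : H] ≤ #A_tors`: every class of `ker f / H` has a torsion representative
  have hrel : H.relIndex f.ker ≤ Nat.card (AddCommGroup.torsion A) := by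
    have hmemT : ∀ t : AddCommGroup.torsion A, (t : A) ∈ f.ker := fun t ↦ by
      rw [AddMonoidHom.mem_ker]
      change (((c t : ℤ)) : ZMod n) = 0
      rw [RankOne.coord_eq_zero_of_isOfFinAddOrder c ((AddCommGroup.mem_torsion _).mp t.2),
        Int.cast_zero]
    let g : AddCommGroup.torsion A → f.ker ⧸ H.addSubgroupOf f.ker :=
      fun t ↦ QuotientAddGroup.mk ⟨(t : A), hmemT t⟩
    have hg : Function.Surjective g := by
      intro q
      induction q using QuotientAddGroup.induction_on with
      | H x =>
        obtain ⟨x, hxk⟩ := x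
        have hx0 : (((c x : ℤ)) : ZMod n) = 0 := by
          rw [AddMonoidHom.mem_ker] at hxk; exact hxk
        rw [ZMod.intCast_zmod_eq_zero_iff_dvd] at hx0
        obtain ⟨a, ha⟩ := hx0
        -- `t = x - n • (a • Q)` is torsion
        have ht : IsOfFinAddOrder (x - (n : ℤ) • (a • Q)) :=
          hker _ (by rw [map_sub, map_zsmul, map_zsmul, hQ, ha]; simp)
        refine ⟨⟨x - (n : ℤ) • (a • Q), (AddCommGroup.mem_torsion _).mpr ht⟩, ?_⟩
        apply QuotientAddGroup.eq.mpr
        rw [AddSubgroup.mem_addSubgroupOf]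
        change -(x - (n : ℤ) • (a • Q)) + x ∈ H
        rw [neg_sub, sub_add_cancel]
        exact ⟨a • Q, rfl⟩
    calc H.relIndex f.ker = (H.addSubgroupOf f.ker).index := rfl
      _ = Nat.card (f.ker ⧸ H.addSubgroupOf f.ker) := AddSubgroup.index_eq_card _
      _ ≤ Nat.card (AddCommGroup.torsion A) := Nat.card_le_card_of_surjective g hg
  have hmul : H.relIndex f.ker * f.ker.index = H.index := AddSubgroup.relIndex_mul_index hHle
  rw [← hmul, hkidx, mul_comm]
  exact Nat.mul_le_mul_left _ hrel

/-- **`[G : H] < ∞` from `[G : T ⊔ H] < ∞` and `T` finite** (`[G : H] = [T ⊔ H : H]·[G : T ⊔ H]`,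
`[T ⊔ H : H] = [T : T ⊓ H] ≤ #T`). [folklore] -/
theorem finiteIndex_of_finiteIndex_torsion_sup {G : Type*} [AddCommGroup G] (T H : AddSubgroup G)
    [Finite T] [(T ⊔ H).FiniteIndex] : H.FiniteIndex := by
  refine ⟨fun h0 ↦ ?_⟩
  have h1 : H.relIndex (T ⊔ H) * (T ⊔ H).index = H.index := AddSubgroup.relIndex_mul_index le_sup_right
  rw [h0, AddSubgroup.relIndex_sup_right] at h1
  rcases mul_eq_zero.mp h1 with h | h
  · exact (AddSubgroup.FiniteIndex.index_ne_zero (H := H.addSubgroupOf T)) h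
  · exact AddSubgroup.FiniteIndex.index_ne_zero h

/-! ## 2. The level bound with the global index decoupled -/

/-- **JSW17 Prop. 3.2.1 (`≤`) at level `p^k`, indices symbolic, global index DECOUPLED.** Let `k ≥ 1`,
`𝔭 ≠ 𝔮 = σ • 𝔭` with every place above `p` equal to `𝔭` or `𝔮`, `T` the torsion subgroup of
`E(K_𝔭)`. If `[E(K_𝔭) : p^kE(K_𝔭) + im E(K)] ≤ L₁`, `[E(K_𝔭) : T + p^kE(K_𝔭)] = M`,
`[E(K) : p^kE(K)] ≤ N`, `[E(K_𝔭) : (T + p^kE(K_𝔭)) + im E(K)] ≤ L₂` and `#(Ш(E/K) ∩ H¹(K,E)[p^k]) ≤ S`,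
then Castella's level-`k` group satisfies `#H¹_{𝓛^{(k)}}(K, E[p^k]) · M ≤ L₁ · (S · (N · L₂))` —
from Poitou–Tate and the local Euler characteristic at `K_𝔮`; NO hypothesis on `E(K)[p]` or
`E(K_𝔭)[p]`. The proof is `SelmerLevelBound.natCard_level_le_of_indices_torsion`'s, keeping `M` and
`N` apart. [cite: JetchevSkinnerWan2017, Prop. 3.2.1 (proof, arXiv:1512.06894 pp. 10–11)]
[cite: Castella2018, proof of Thm. 2.3, (3.2.1) and (calcul) (arXiv:1704.06608 pp. 5–6)]
[cite: MilneADT2006, Ch. I, Thm. 4.10(b) and Thm. 2.8] -/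
theorem natCard_level_mul_le_of_indices (W : WeierstrassCurve ℚ) [W.IsElliptic] (K : Type) [Field K]
    [NumberField K] (p k : ℕ) [Fact p.Prime] (𝔭 𝔮 : HeightOneSpectrum (𝓞 K))
    (hk : 0 < k) (σ : K ≃ₐ[ℚ] K) (hσ : σ • 𝔭 = 𝔮)
    (h𝔮 : ∀ v : HeightOneSpectrum (𝓞 K), v ≠ 𝔭 → ((p : ℕ) : 𝓞 K) ∈ v.asIdeal → v = 𝔮)
    (hPT : poitouTate_sum_localTatePairing_eq_zero K)
    (hEP : localEulerPoincareCharacteristic (𝔮.adicCompletion K))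
    {L₁ L₂ M N S : ℕ}
    (hL₁ : ((Affine.Point.baseChange (W' := W.baseChange K) K (𝔭.adicCompletion K)).range ⊔
        (zsmulAddGroupHom ((p ^ k : ℕ) : ℤ) :
          ((W.baseChange K).baseChange (𝔭.adicCompletion K)).toAffine.Point →+ _).range).index ≤ L₁)
    (hM : (AddCommGroup.torsion ((W.baseChange K).baseChange (𝔭.adicCompletion K)).toAffine.Point ⊔
        (zsmulAddGroupHom ((p ^ k : ℕ) : ℤ) :
          ((W.baseChange K).baseChange (𝔭.adicCompletion K)).toAffine.Point →+ _).range).index = M)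
    (hN : ((zsmulAddGroupHom ((p ^ k : ℕ) : ℤ) : (W.baseChange K).toAffine.Point →+ _).range).index ≤ N)
    (hL₂ : ((Affine.Point.baseChange (W' := W.baseChange K) K (𝔭.adicCompletion K)).range ⊔
        (AddCommGroup.torsion ((W.baseChange K).baseChange (𝔭.adicCompletion K)).toAffine.Point ⊔
          (zsmulAddGroupHom ((p ^ k : ℕ) : ℤ) :
            ((W.baseChange K).baseChange (𝔭.adicCompletion K)).toAffine.Point →+ _).range)).index ≤ L₂)
    (hS : Nat.card ↥((W.baseChange K).sha ⊓
        AddSubgroup.torsionBy (W.baseChange K).galH1 ((p ^ k : ℕ) : ℤ)) ≤ S) :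
    Finite (acLevelStructure (W.baseChange K) p k 𝔭 ∅).selmerGroup ∧
      Nat.card (acLevelStructure (W.baseChange K) p k 𝔭 ∅).selmerGroup * M ≤ L₁ * (S * (N * L₂)) := by
  haveI hEK : (W.baseChange K).IsElliptic := by rw [baseChange]; infer_instance
  haveI : NeZero (p ^ k) := ⟨pow_ne_zero _ (Fact.out : p.Prime).ne_zero⟩
  haveI : CharZero (𝔭.adicCompletion K) := charZero_adicCompletion 𝔭
  have hnZ : ((p ^ k : ℕ) : ℤ) ≠ 0 := Int.natCast_ne_zero.mpr (NeZero.ne _)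
  set E := W.baseChange K with hE
  set n : ℕ := p ^ k with hn
  set Sel := selmerGroup E (n : ℤ) with hSel
  set KO := kummerOutside E n {Sum.inr 𝔮} with hKO
  set C := ((AddCommGroup.torsion (E.baseChange (𝔭.adicCompletion K)).toAffine.Point).map
      (E.localKummerMap (𝔭.adicCompletion K) hnZ)).comap
    (galoisCohomology.res (E.torsionGaloisModule (n : ℤ)) (𝔭.adicCompletion K) 1) with hC
  -- (1) glue, torsion-valued condition at `𝔭`
  have hT : ∀ v : HeightOneSpectrum (𝓞 K), v ≠ 𝔭 →
      (((p : ℕ) : 𝓞 K) ∈ v.asIdeal ∨ v ∈ (∅ : Set (HeightOneSpectrum (𝓞 K)))) →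
        (Sum.inr v : Place K) ∈ ({Sum.inr 𝔮} : Finset (Place K)) := by
    rintro v hv (hpv | hv0)
    · rw [h𝔮 v hv hpv, Finset.mem_singleton]
    · exact absurd hv0 (Set.notMem_empty v)
  haveI hKOfin : Finite KO := finite_kummerOutside E n {Sum.inr 𝔮}
  haveI : Finite ↥(KO ⊓ C) := Finite.of_injective _ (AddSubgroup.inclusion_injective inf_le_left)
  haveI : Finite ↥(kummerOutside E (p ^ k) {Sum.inr 𝔮} ⊓
      ((AddCommGroup.torsion
          (E.baseChange (Place.Completion (Sum.inr 𝔭 : Place K))).toAffine.Point).map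
        (E.localKummerMap (Place.Completion (Sum.inr 𝔭 : Place K)) hnZ)).comap
        (galoisCohomology.localization (E.torsionGaloisModule ((p ^ k : ℕ) : ℤ)) (Sum.inr 𝔭) 1)) :=
    Finite.of_injective _ (AddSubgroup.inclusion_injective inf_le_left)
  obtain ⟨hfin, hglue⟩ :=
    LevelKummer.finite_and_natCard_selmerGroup_acLevelStructure_le_torsion E p k 𝔭 ∅ {Sum.inr 𝔮}
      hT hnZ
  refine ⟨hfin, ?_⟩
  have hglue' : Nat.card (acLevelStructure E p k 𝔭 ∅).selmerGroup ≤ Nat.card ↥(KO ⊓ C) := hglue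
  -- (2) `#(KO ⊓ C) ≤ [KO : Sel] · #(Sel ⊓ C)`
  have hSelKO : Sel ≤ KO := selmerGroup_le_kummerOutside E n _
  have h2 : Nat.card ↥(KO ⊓ C) ≤ Sel.relIndex KO * Nat.card ↥(Sel ⊓ C) :=
    natCard_inf_le_relIndex_mul KO Sel C hSelKO
  -- (3) Part B at `𝔮`, then the symmetry `𝔮 ↔ 𝔭`
  have hpp : IsPrimePow n := ⟨p, k, (Fact.out : p.Prime).prime, hk, rfl⟩
  have hB : Sel.relIndex KO ≤ L₁ := by
    have h := Relaxation.relIndex_selmerGroup_kummerOutside_le_of_facts E n 𝔮 hpp hPT hEP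
    rw [← LocalIndexSymmetry.index_range_baseChange_sup_eq_of_algEquiv_smul W σ hσ (n : ℤ)] at h
    exact h.trans hL₁
  -- (4) Part A with the torsion-valued condition at `𝔭`, indices kept apart
  have hA : Nat.card ↥(Sel ⊓ C) * M ≤ S * (N * L₂) := by
    have hdiv := E.zsmul_geomPoints_surjective_holds hnZ
    have h := StrictAtPlace.natCard_selmerGroup_inf_comap_mul_index_le E (𝔭.adicCompletion K) hnZ
      hdiv (AddCommGroup.torsion (E.baseChange (𝔭.adicCompletion K)).toAffine.Point)
    change Nat.card ↥(Sel ⊓ C) * _ ≤ _ at h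
    rw [hM] at h
    exact h.trans (Nat.mul_le_mul hS (Nat.mul_le_mul hN hL₂))
  calc Nat.card (acLevelStructure E p k 𝔭 ∅).selmerGroup * M
      ≤ (Sel.relIndex KO * Nat.card ↥(Sel ⊓ C)) * M := Nat.mul_le_mul_right _ (hglue'.trans h2)
    _ = Sel.relIndex KO * (Nat.card ↥(Sel ⊓ C) * M) := by ring
    _ ≤ L₁ * (S * (N * L₂)) := Nat.mul_le_mul hB hA

/-! ## 3. Finiteness of `Sel_𝔭(K, E[p^∞])` at a rank-one datum, any `p`, no `Irr`, no `Mult` -/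

/-- **`Sel_𝔭(K, E[p^∞])` is FINITE at a rank-one datum — ANY prime `p`, ANY reduction type at `p`,
`E(K)[p]` arbitrary.** For an elliptic, globally minimal `W/ℚ`, a prime `p`, an imaginary quadratic
field `K` in which `p` splits, with `rank E(K) = 1` and `#Ш(E/K)[p^∞] < ∞`, and a prime `𝔭 ∋ p` of
`K`: Castella's Selmer group over `K` (strict at `𝔭`, relaxed at `𝔭̄`, trivial off `p`;
`X11b.AcSelmer.selmerAcBase (W_K) p 𝔭 ∅`) is finite. Proof: the level bound
`natCard_level_mul_le_of_indices` at every `k ≥ 1` with `M = p^k` (`[E(ℚ_p) : T + p^kE(ℚ_p)]`, a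
`ℤ_p`-line of finite index `E⁽²⁾(ℚ_p) ≅ ℤ_p` inside `E(ℚ_p)`, `LocalIndex.index_torsion_sup_range_nsmul`),
`N = p^k · #E(K)_tors` (`index_range_zsmul_le_mul_card_torsion`), `L₁ ≤ p^{e_Q − m}·p^m`,
`L₂ ≤ p^{e_Q − m}` (the image of a generator `Q` of `E(K)/tors`, of infinite order in `E(ℚ_p)`:
`LocalIndex.index_range_nsmul_sup_zmultiples_le` / `index_torsion_sup_range_nsmul_sup_zmultiples`,
monotonicity of the index), `S = #Ш[p^∞]`; `p^k` cancels, the bound is uniform in `k`, and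
`LevelKummer.exists_finite_selmerAcBase_natCard_le` passes to the limit. CONDITIONAL on `hPT`, `hEP`. [cite: JetchevSkinnerWan2017, Prop. 3.2.1 (proof, arXiv:1512.06894 pp. 10–11)]
[cite: Castella2018, proof of Thm. 2.3, (3.2.1) and (calcul) (arXiv:1704.06608 pp. 5–6)]
[cite: MilneADT2006, Ch. I, Thm. 4.10(b) and Thm. 2.8] -/
theorem finite_selmerAcBase_of_rankOne (W : WeierstrassCurve ℚ) [W.IsElliptic]
    [W.IsGloballyMinimal] (p : ℕ) [Fact p.Prime] (K : Type) [Field K] [NumberField K]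
    (hPT : poitouTate_sum_localTatePairing_eq_zero K)
    (hEP : ∀ v : HeightOneSpectrum (𝓞 K), localEulerPoincareCharacteristic (v.adicCompletion K))
    (hK : IsImaginaryQuadratic K) (hsplit : SplitsIn K p)
    (hrank : (W.baseChange K).mordellWeilRank = 1)
    (hSha : Finite (AddCommGroup.primaryComponent (W.baseChange K).sha p))
    (𝔭 : HeightOneSpectrum (𝓞 K)) (h𝔭 : ((p : ℕ) : 𝓞 K) ∈ 𝔭.asIdeal) :
    Finite (selmerAcBase (W.baseChange K) p 𝔭 ∅) := by
  set E := W.baseChange K with hEdef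
  set G := W.baseChange ℚ_[p] with hGdef
  haveI hEK : E.IsElliptic := by rw [hEdef, baseChange]; infer_instance
  have h2 : Module.finrank ℚ K = 2 := hK.1
  have hp : p.Prime := Fact.out
  haveI := hSha
  obtain ⟨he, hf⟩ := degreeOne_of_splitsIn h2 hsplit h𝔭
  set ιp := embAt K p 𝔭 h𝔭 he hf with hιp
  set f : E.toAffine.Point →+ G.toAffine.Point := Affine.Point.map (W' := W) ιp.toRatAlgHom with hfdef
  have hfinj : Function.Injective f := Affine.Point.map_injective (W' := W) ιp.toRatAlgHom
  -- a coordinate `c : E(K) → ℤ` and a generator `Q` of `E(K)/tors`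
  obtain ⟨c, Q, hcQ, hcker⟩ := RankOne.exists_coord_of_mordellWeilRank_eq_one E hrank
  have hA : ∀ a : E.toAffine.Point, IsOfFinAddOrder (a - c a • Q) :=
    RankOne.isOfFinAddOrder_sub_coord_zsmul c Q hcQ hcker
  have hQinf : ¬ IsOfFinAddOrder Q := fun hQ => by
    have h := RankOne.coord_eq_zero_of_isOfFinAddOrder c hQ
    rw [hcQ] at h
    exact one_ne_zero h
  have hxinf : ¬ IsOfFinAddOrder (f Q) := fun hx => hQinf ((hfinj.isOfFinAddOrder_iff).mp hx)
  -- the torsion of `E(K)` is finite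
  haveI hTK : Finite (AddCommGroup.torsion E.toAffine.Point) := E.finite_torsion_point
  set t := Nat.card (AddCommGroup.torsion E.toAffine.Point) with htdef
  -- the `ℤ_p`-coordinate `Ψ` on `E(ℚ_p)`: `Ψ(E(ℚ_p)) = p^m ℤ_p`, `p^m = #E(ℚ_p)[p^∞]`
  haveI hfi2 : (G.formalFiltration 2).FiniteIndex := G.finiteIndex_formalFiltration 2
  obtain ⟨φ, -⟩ := LocalIndex.exists_addEquiv_valuation_psi_padicPointOf W p (K := K)
  obtain ⟨m, hmrange, hmcard, hmle⟩ :=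
    LocalIndex.exists_pow_eq_card_and_le_valuation_psi (G.formalFiltration 2) φ
  set Ψ := LocalIndex.psi (G.formalFiltration 2) φ with hΨ
  set eQ := (Ψ (f Q)).valuation with heQdef
  have hΨQ : Ψ (f Q) ≠ 0 := fun h0 => hxinf ((LocalIndex.psi_eq_zero_iff _ φ _).mp h0)
  have hmeQ : m ≤ eQ := hmle (f Q) hΨQ
  haveI hTG : Finite (AddCommGroup.torsion G.toAffine.Point) :=
    LocalIndex.finite_torsion (G.formalFiltration 2) φ
  -- the two primes above `p`
  obtain ⟨σ, 𝔮, hσ, -, -, hall⟩ := LocalIndexTransport.exists_conj_prime_of_splitsIn K p h2 hsplit h𝔭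
  have h𝔮 : ∀ v : HeightOneSpectrum (𝓞 K), v ≠ 𝔭 → ((p : ℕ) : 𝓞 K) ∈ v.asIdeal → v = 𝔮 :=
    fun v hv hpv => (hall v hpv).resolve_left hv
  -- `#Ш[p^∞]`
  set S := Nat.card (AddCommGroup.primaryComponent E.sha p) with hSdef
  -- THE LEVEL BOUNDS, uniform in `k`
  set B : ℕ := p ^ eQ * (S * (t * p ^ eQ)) with hBdef
  have hBpos : 1 ≤ B := by
    have hS1 : 1 ≤ S := Nat.one_le_iff_ne_zero.mpr (by rw [hSdef]; exact Nat.card_pos.ne')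
    have ht1 : 1 ≤ t := Nat.one_le_iff_ne_zero.mpr (by rw [htdef]; exact Nat.card_pos.ne')
    calc 1 = 1 * (1 * (1 * 1)) := by norm_num
      _ ≤ p ^ eQ * (S * (t * p ^ eQ)) := Nat.mul_le_mul (Nat.one_le_pow _ _ hp.pos)
          (Nat.mul_le_mul hS1 (Nat.mul_le_mul ht1 (Nat.one_le_pow _ _ hp.pos)))
  have hlevel : ∀ k, Finite (acLevelStructure E p k 𝔭 ∅).selmerGroup ∧
      Nat.card (acLevelStructure E p k 𝔭 ∅).selmerGroup ≤ B := by
    intro k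
    rcases Nat.eq_zero_or_pos k with rfl | hk
    · obtain ⟨hfin, hle⟩ := finite_and_natCard_selmerGroup_acLevelStructure_zero E p 𝔭 ∅
      exact ⟨hfin, hle.trans hBpos⟩
    · -- the subgroups of `E(ℚ_p)` at level `k`
      set Tq : AddSubgroup G.toAffine.Point := AddCommGroup.torsion G.toAffine.Point with hTq
      set Pk : AddSubgroup G.toAffine.Point :=
        (nsmulAddMonoidHom (p ^ k) : G.toAffine.Point →+ _).range with hPk
      set H₀ : AddSubgroup G.toAffine.Point := Pk ⊔ AddSubgroup.zmultiples (f Q) with hH₀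
      -- `[G : T ⊔ H₀] = p^{min(k, eQ − m)}` (finite), hence `H₀` has finite index
      have hTH₀ : (Tq ⊔ H₀).index = p ^ min k (eQ - m) :=
        LocalIndex.index_torsion_sup_range_nsmul_sup_zmultiples (G.formalFiltration 2) φ hmrange
          (f Q) hxinf k
      haveI : (Tq ⊔ H₀).FiniteIndex := ⟨by rw [hTH₀]; exact pow_ne_zero _ hp.ne_zero⟩
      haveI hH₀fi : H₀.FiniteIndex := finiteIndex_of_finiteIndex_torsion_sup Tq H₀
      have hfQ : AddSubgroup.zmultiples (f Q) ≤ f.range := by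
        rw [AddSubgroup.zmultiples_le]; exact ⟨Q, rfl⟩
      have hmin : p ^ min k (eQ - m) ≤ p ^ (eQ - m) := Nat.pow_le_pow_right hp.pos (min_le_right _ _)
      have hpow : p ^ (eQ - m) * p ^ m = p ^ eQ := by rw [← pow_add, Nat.sub_add_cancel hmeQ]
      -- `L₁ ≤ p^{eQ}`
      have hL₁ : ((Affine.Point.baseChange (W' := W.baseChange K) K (𝔭.adicCompletion K)).range ⊔
          (zsmulAddGroupHom ((p ^ k : ℕ) : ℤ) :
            ((W.baseChange K).baseChange (𝔭.adicCompletion K)).toAffine.Point →+ _).range).index ≤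
          p ^ eQ := by
        rw [LocalIndexTransport.index_range_baseChange_sup_eq_padic K p 𝔭 h𝔭 he hf W,
          RankOne.range_zsmulAddGroupHom_natCast, sup_comm]
        change (Pk ⊔ f.range).index ≤ _
        calc (Pk ⊔ f.range).index ≤ H₀.index := AddSubgroup.index_antitone (sup_le_sup_left hfQ _)
          _ ≤ p ^ min k (eQ - m) * Nat.card (AddCommGroup.primaryComponent G.toAffine.Point p) :=
              LocalIndex.index_range_nsmul_sup_zmultiples_le (G.formalFiltration 2) φ hmrange
                (f Q) hxinf k
          _ ≤ p ^ (eQ - m) * p ^ m := by rw [hmcard]; exact Nat.mul_le_mul_right _ hmin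
          _ = p ^ eQ := hpow
      -- `M = p^k`
      have hM : (AddCommGroup.torsion ((W.baseChange K).baseChange (𝔭.adicCompletion K)).toAffine.Point ⊔
          (zsmulAddGroupHom ((p ^ k : ℕ) : ℤ) :
            ((W.baseChange K).baseChange (𝔭.adicCompletion K)).toAffine.Point →+ _).range).index =
          p ^ k := by
        rw [index_torsion_sup_range_zsmul_eq_padic K p 𝔭 h𝔭 he hf W,
          RankOne.range_zsmulAddGroupHom_natCast]
        exact LocalIndex.index_torsion_sup_range_nsmul (G.formalFiltration 2) φ k
      -- `N ≤ p^k · #E(K)_tors`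
      have hN : ((zsmulAddGroupHom ((p ^ k : ℕ) : ℤ) : E.toAffine.Point →+ _).range).index ≤
          p ^ k * t := by
        haveI : NeZero (p ^ k) := ⟨pow_ne_zero _ hp.ne_zero⟩
        exact index_range_zsmul_le_mul_card_torsion c Q hcQ hcker (p ^ k)
      -- `L₂ ≤ p^{eQ}`
      have hL₂ : ((Affine.Point.baseChange (W' := W.baseChange K) K (𝔭.adicCompletion K)).range ⊔
          (AddCommGroup.torsion ((W.baseChange K).baseChange (𝔭.adicCompletion K)).toAffine.Point ⊔
            (zsmulAddGroupHom ((p ^ k : ℕ) : ℤ) :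
              ((W.baseChange K).baseChange (𝔭.adicCompletion K)).toAffine.Point →+ _).range)).index ≤
          p ^ eQ := by
        rw [index_range_baseChange_sup_torsion_sup_eq_padic K p 𝔭 h𝔭 he hf W,
          RankOne.range_zsmulAddGroupHom_natCast]
        change (f.range ⊔ (Tq ⊔ Pk)).index ≤ _
        have hle : Tq ⊔ H₀ ≤ f.range ⊔ (Tq ⊔ Pk) := by
          refine sup_le (le_sup_right.trans' le_sup_left) (sup_le ?_ ?_)
          · exact le_sup_right.trans' le_sup_right
          · exact hfQ.trans le_sup_left
        calc (f.range ⊔ (Tq ⊔ Pk)).index ≤ (Tq ⊔ H₀).index := AddSubgroup.index_antitone hle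
          _ = p ^ min k (eQ - m) := hTH₀
          _ ≤ p ^ (eQ - m) := hmin
          _ ≤ p ^ (eQ - m) * p ^ m := Nat.le_mul_of_pos_right _ (pow_pos hp.pos _)
          _ = p ^ eQ := hpow
      obtain ⟨hfin, hle⟩ := natCard_level_mul_le_of_indices W K p k 𝔭 𝔮 hk σ hσ h𝔮 hPT (hEP 𝔮)
        hL₁ hM hN hL₂ (SelmerCount.natCard_sha_inf_torsionBy_le_of_finite E p k).2
      refine ⟨hfin, ?_⟩
      -- cancel `p^k`
      have hkey : Nat.card (acLevelStructure E p k 𝔭 ∅).selmerGroup * p ^ k ≤ B * p ^ k := by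
        calc Nat.card (acLevelStructure E p k 𝔭 ∅).selmerGroup * p ^ k
            ≤ p ^ eQ * (S * (p ^ k * t * p ^ eQ)) := hle
          _ = B * p ^ k := by rw [hBdef]; ring
      exact Nat.le_of_mul_le_mul_right hkey (pow_pos hp.pos k)
  -- pass to the limit
  obtain ⟨hfinSel, -⟩ := LevelKummer.exists_finite_selmerAcBase_natCard_le E p 𝔭 ∅
    E.zsmul_geomPoints_surjective_holds B (fun k => (hlevel k).1) (fun k => (hlevel k).2)
  exact hfinSel

/-! ## 4. Link A modulo Poitou–Tate and the local Euler–Poincaré characteristic -/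

/-- **Link A `TwoAdicControlOfRankOne` holds, granted Poitou–Tate global duality (Milne ADT I Thm.
4.10 with Cor. 2.3, `poitouTate_sum_localTatePairing_eq_zero`) and Tate's local Euler–Poincaré
characteristic formula (Milne ADT I Thm. 2.8, `localEulerPoincareCharacteristic`) at the number
fields and places where Link A is demanded.** At a datum of Link A (square-free `n`, `K` imaginary
quadratic with the Heegner hypothesis for `2`, so `2` splits in `K`; `v̄ ∋ 2`; `rank E_n(K) = 1`,
`#Ш(E_n/K)[2^∞] < ∞`) the base Selmer group `Sel_{v̄}(K, E_n[2^∞])` is finite by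
`finite_selmerAcBase_of_rankOne` (`E_n` is elliptic and globally minimal for square-free `n`), and the
landed `twoAdicControlOfRankOne_of_finite_selmerAcBase` does the rest. So, in the kernel and modulo
two TEXTBOOK theorems, the algebraic link of crux B's split is settled at the ADDITIVE prime `2`; the
research content of crux B `AnalyticRankOneOfRankOneFiniteShaTwo` is Link B
`TwoAdicCharValueEqHeegnerLogSq` (with the refereed inputs of `cruxB_of_twoAdicLinks`). Nothing about
BSD, the leaf or crux B itself is proved. [cite: MilneADT2006, Ch. I, Thm. 4.10(b) and Thm. 2.8]
[cite: JetchevSkinnerWan2017, Prop. 3.2.1 and §3.3] [cite: GreenbergLNM1716, §3 Lemma 3.3, p. 90; §4 Lemma 4.2]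
[cite: Castella2018, Def. 2.2 and Thm. 2.3 (arXiv:1704.06608 p. 5) (shape)] -/
theorem twoAdicControlOfRankOne_of_poitouTate_of_localEulerChar
    (hPT : ∀ (K : Type) [Field K] [NumberField K], poitouTate_sum_localTatePairing_eq_zero K)
    (hEP : ∀ (K : Type) [Field K] [NumberField K] (v : HeightOneSpectrum (𝓞 K)),
      localEulerPoincareCharacteristic (v.adicCompletion K)) :
    CongruentShaFreeCutTwoAdicLinks.TwoAdicControlOfRankOne :=
  CongruentShaFreeCutTwoAdicControlOfSelmerFinite.twoAdicControlOfRankOne_of_finite_selmerAcBase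
    fun n hn K _ _ _N _ _hN hK _hHN hH2 _ι _v vbar _hv hvbar _hne hrank hsha ↦ by
      haveI := isElliptic_congruentNumberCurve hn.ne_zero
      haveI := isGloballyMinimal_congruentNumberCurve hn
      exact finite_selmerAcBase_of_rankOne (congruentNumberCurve n) 2 K (hPT K) (hEP K) hK
        (hH2 2 Fact.out (dvd_refl 2)) hrank hsha vbar hvbar

end Summit.BirchSwinnertonDyer.BirchSwinnertonDyer.Theorems.CongruentShaFreeCutTwoAdicSelmerFinite

end
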